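import Summits.AtomisticToContinuum.FouriersLaw.Theorems.BondHeatUncertaintySubdiffusiveBondHeatJunctionRatioGibbsAdjoint
import Summits.AtomisticToContinuum.FouriersLaw.Theorems.BondHeatUncertaintySubdiffusiveBondHeatJunctionRatioBracketPointwise
import Summits.AtomisticToContinuum.FouriersLaw.Theorems.BondHeatUncertaintySubdiffusiveBondHeatJunctionRatioTransferBound

/-!
# `JunctionRatioBracketGibbs` — file 23d of the junction-ratio programme: the equilibrium
# identity (G1b) `⟨p_b Ψ⟩_T = T` at both bath ends

Route `BondHeatUncertainty`, residual `BoundedResponse` (stmt-AtomisticToContinuum-11071), leaf [BI]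
`EscapeGrading.FirstBondBracket` (19b), g64 weak-form skeleton, piece **[GIBBS] (G1b)**: for
`P = pinnedChain ω₂ lam β γ` (`ω₂ > 0`, `lam, β, γ ≥ 0`, `T > 0`, `N ≥ 3`, `ρ_T = e^{-H/T}`) and the transfer
observable `Ψ = L(Lψ) - γLψ + κψ` of 19b (`ψ = p_j/V″(q_j - q_b)`, `L = L_{T,T}`): `∫ p_b Ψ_T(b,j) ρ_T = T ∫ ρ_T`
at the hot end `(b,j) = (0,1)` and the cold end `(N-1,N-2)`, i.e. `∫ p_b Ψ dμ_T = T` (§D).  Proof (§C, any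
bath end, `Φ = Lψ`): `⟨p_bΨ⟩ = ⟨p_b,LΦ⟩ - γ⟨p_bΦ⟩ + ⟨p_b κψ⟩`; `⟨p_bΦ⟩ = 0` (`Φ` even in `p`), `⟨p_b κψ⟩ = 0`
(`κψ` is `p_b`-free); (ADJ-p) of 23c: `⟨p_b,LΦ⟩ = ⟨∂_{q_b}H, Lψ⟩`; (ADJ-q) (§A, from 23c's adjoint identity):
`⟨g(q), Lψ⟩ = -⟨Σ_i p_i ∂_{q_i}g, ψ⟩`; the Hessian column at a bath site (22b) is `κ p_b - V″ p_j` and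
`V″ψ = p_j`, so the total is `⟨p_j²⟩ = T∫ρ_T` (23a).  §B: temperedness bookkeeping (atoms of 21a, sizes of
21c/21d, transport under the site reflection for the cold end).  No definitions; all theorems fully proved.
-/

noncomputable section

open MeasureTheory Filter Topology Set
open scoped BigOperators ContDiff

namespace Summit.AtomisticToContinuum.FouriersLaw.Theorems.SubdiffusiveBondHeat.EscapeGrading

open Literature.MathematicalPhysics.KineticTheory.HeatConduction
variable {N : ℕ} {ω₂ lam β γ : ℝ}

/-! ## A. (ADJ-q) and three complements to the tempered class -/

/-- **(ADJ-q)** For `g ∈ C¹(q)` with `g(q), ∂_{q_i}g` tempered and `F ∈ C²` with `F, ∂F, ∂²_{p_i}F`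
tempered: `∫ g(q) (L F) ρ_T = - ∫ (Σ_i p_i ∂_{q_i}g) F ρ_T` (no bath term: `∂_{p_i} g = 0`). -/
theorem integral_comp_fst_mul_generator_mul_gibbsDensity_eq (hω : 0 < ω₂) (hl : 0 ≤ lam) (hβ : 0 ≤ β)
    (γ : ℝ) {T : ℝ} (hT : 0 < T) {g : (Fin N → ℝ) → ℝ} (hg1 : ContDiff ℝ 1 g)
    (hG : IsTempered ω₂ lam β γ N (fun y : PhaseSpace N => g y.1))
    (hGq : ∀ i, IsTempered ω₂ lam β γ N (partialQ i (fun y : PhaseSpace N => g y.1)))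
    {F : PhaseSpace N → ℝ} (hF2 : ContDiff ℝ 2 F) (hF : IsTempered ω₂ lam β γ N F)
    (hFq : ∀ i, IsTempered ω₂ lam β γ N (partialQ i F))
    (hFp : ∀ i, IsTempered ω₂ lam β γ N (partialP i F))
    (hFpp : ∀ i, IsTempered ω₂ lam β γ N (partialP i (partialP i F))) :
    ∫ x, g x.1 * (pinnedChain ω₂ lam β γ).generator N T T F x *
        (pinnedChain ω₂ lam β γ).gibbsDensity N T x =
      -∫ x, (∑ i, x.2 i * partialQ i (fun y : PhaseSpace N => g y.1) x) * F x *
          (pinnedChain ω₂ lam β γ).gibbsDensity N T x := by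
  have hG1 : ContDiff ℝ 1 (fun y : PhaseSpace N => g y.1) := hg1.comp contDiff_fst
  have hGp : ∀ i, partialP i (fun y : PhaseSpace N => g y.1) = fun _ => 0 := fun i => by
    funext z; simp [partialP]
  have h := integral_mul_generator_mul_gibbsDensity_eq hω hl hβ γ hT hF2 hG1 hF hG hFq hFp hFpp hGq
    (fun i => by rw [hGp i]; exact IsTempered.const 0)
  rw [h]
  simp only [hGp, mul_zero, sub_zero, zero_mul, integral_zero, Finset.sum_const_zero]

namespace IsTempered
variable {F G : PhaseSpace N → ℝ}

/-- Transfer of temperedness along a pointwise identity. -/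
theorem of_eq (hG : IsTempered ω₂ lam β γ N G) (h : ∀ x, F x = G x) : IsTempered ω₂ lam β γ N F :=
  hG.of_abs_le fun x => by rw [h x]

/-- Finite sums of tempered functions are tempered (`H ≥ 0`). -/
theorem sum (hω : 0 ≤ ω₂) (hl : 0 ≤ lam) (hβ : 0 ≤ β) {ι : Type*} (s : Finset ι)
    {F : ι → PhaseSpace N → ℝ} (h : ∀ i ∈ s, IsTempered ω₂ lam β γ N (F i)) :
    IsTempered ω₂ lam β γ N fun x => ∑ i ∈ s, F i x := by
  classical
  unfold IsTempered at h
  choose! C m hC using h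
  refine ⟨∑ i ∈ s, |C i|, ∑ i ∈ s, m i, fun x => ?_⟩
  have hb : (1 : ℝ) ≤ 1 + (pinnedChain ω₂ lam β γ).hamiltonian N x :=
    le_add_of_nonneg_right (pinnedChain_hamiltonian_nonneg hω hl hβ γ N x)
  have h0 : (0 : ℝ) ≤ 1 + (pinnedChain ω₂ lam β γ).hamiltonian N x := zero_le_one.trans hb
  calc |∑ i ∈ s, F i x| ≤ ∑ i ∈ s, |F i x| := Finset.abs_sum_le_sum_abs _ _
    _ ≤ ∑ i ∈ s, |C i| * (1 + (pinnedChain ω₂ lam β γ).hamiltonian N x) ^ ∑ k ∈ s, m k :=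
        Finset.sum_le_sum fun i hi => (hC i hi x).trans
          (mul_le_mul (le_abs_self _)
            (pow_le_pow_right₀ hb (Finset.single_le_sum (fun k _ => Nat.zero_le (m k)) hi))
            (pow_nonneg h0 _) (abs_nonneg _))
    _ = (∑ i ∈ s, |C i|) * (1 + (pinnedChain ω₂ lam β γ).hamiltonian N x) ^ ∑ k ∈ s, m k := by
        rw [Finset.sum_mul]

/-- Transport under the site reflection `R` (`H ∘ R = H` since `V` is even). -/
theorem comp_siteReflection (hF : IsTempered ω₂ lam β γ N F) :
    IsTempered ω₂ lam β γ N (F ∘ siteReflection N) :=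
  hF.imp fun C hC => hC.imp fun m h x => by
    rw [Function.comp_apply, ← (pinnedChain ω₂ lam β γ).hamiltonian_siteReflection
      (pinnedChain_V_neg ω₂ lam β γ) N x]
    exact h _

end IsTempered

/-! ## B. Temperedness bookkeeping: atoms, `ψ`, `Φ₁ = Lψ` and its partials, Hessian entries -/

/-- `φ(q_j - q_i)`, `φ′(q_j - q_i)`, `φ″(q_j - q_i)` are bounded, hence tempered. -/
theorem isTempered_transferPhi (hβ : 0 ≤ β) (i j : Fin N) :
    IsTempered ω₂ lam β γ N (fun x => transferPhi β (x.1 j - x.1 i)) ∧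
      IsTempered ω₂ lam β γ N (fun x => transferDPhi β (x.1 j - x.1 i)) ∧
        IsTempered ω₂ lam β γ N (fun x => transferDDPhi β (x.1 j - x.1 i)) :=
  ⟨IsTempered.of_bounded fun _ => abs_transferPhi_le hβ _,
    IsTempered.of_bounded fun _ => abs_transferDPhi_le hβ _,
    IsTempered.of_bounded fun _ => abs_transferDDPhi_le hβ _⟩

/-- `U′(q_k)` and `U″(q_k)` are tempered (polynomials in `q_k`). -/
theorem isTempered_pinForce (hω : 0 < ω₂) (hl : 0 ≤ lam) (hβ : 0 ≤ β) (k : Fin N) :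
    IsTempered ω₂ lam β γ N (fun x => pinForce ω₂ lam (x.1 k)) ∧
      IsTempered ω₂ lam β γ N (fun x => pinStiff ω₂ lam (x.1 k)) :=
  ⟨((IsTempered.fst hω hl hβ k).const_mul ω₂).add hω.le hl hβ
      (((IsTempered.fst hω hl hβ k).pow 3).const_mul lam),
    (IsTempered.const ω₂).add hω.le hl hβ (((IsTempered.fst hω hl hβ k).pow 2).const_mul (3 * lam))⟩

/-- `V′(q_j - q_i)` and `V″(q_j - q_i)` are tempered (polynomials in `q_i, q_j`). -/
theorem isTempered_bondForce (hω : 0 < ω₂) (hl : 0 ≤ lam) (hβ : 0 ≤ β) (i j : Fin N) :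
    IsTempered ω₂ lam β γ N (fun x => bondForce β (x.1 j - x.1 i)) ∧
      IsTempered ω₂ lam β γ N (fun x => bondStiff β (x.1 j - x.1 i)) :=
  ⟨((IsTempered.fst hω hl hβ j).sub hω.le hl hβ (IsTempered.fst hω hl hβ i)).add hω.le hl hβ
      ((((IsTempered.fst hω hl hβ j).sub hω.le hl hβ (IsTempered.fst hω hl hβ i)).pow 3).const_mul β),
    (IsTempered.const 1).add hω.le hl hβ
      ((((IsTempered.fst hω hl hβ j).sub hω.le hl hβ (IsTempered.fst hω hl hβ i)).pow 2).const_mul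
        (3 * β))⟩

/-- `ψ = p_j φ(q_j - q_i)`, `∂_{q_l}ψ`, `∂_{p_l}ψ`, `∂²_{p_l}ψ` are tempered (explicit forms of 21a). -/
theorem isTempered_transferTest (hω : 0 < ω₂) (hl : 0 ≤ lam) (hβ : 0 ≤ β) (i j l : Fin N) :
    IsTempered ω₂ lam β γ N (transferTest β N i j) ∧
      IsTempered ω₂ lam β γ N (partialQ l (transferTest β N i j)) ∧
        IsTempered ω₂ lam β γ N (partialP l (transferTest β N i j)) ∧
          IsTempered ω₂ lam β γ N (partialP l (partialP l (transferTest β N i j))) := by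
  obtain ⟨ph, dph, -⟩ := isTempered_transferPhi (ω₂ := ω₂) (lam := lam) (γ := γ) hβ i j
  exact ⟨by rw [transferTest_eq]; exact (IsTempered.snd hω.le hl hβ j).mul ph,
    ((IsTempered.snd hω.le hl hβ j).mul (dph.mul (IsTempered.const _))).of_eq
      (partialQ_transferTest hβ i j l),
    ((IsTempered.const _).mul ph).of_eq (partialP_transferTest β i j l),
    (IsTempered.const 0).of_eq (partialP_partialP_transferTest β i j l)⟩

/-- The hot size `m(x) = 1 + |q_0| + |q_1| + |q_2| + |p_0| + |p_1| + |p_2|` is tempered. -/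
theorem isTempered_hotSize (hω : 0 < ω₂) (hl : 0 ≤ lam) (hβ : 0 ≤ β) (hN : 3 ≤ N) :
    IsTempered ω₂ lam β γ N (hotSize N hN) := by
  have ha : ∀ k, IsTempered ω₂ lam β γ N fun x => |x.1 k| := fun k =>
    (IsTempered.fst hω hl hβ k).of_abs_le fun x => by rw [abs_abs]
  have hb : ∀ k, IsTempered ω₂ lam β γ N fun x => |x.2 k| := fun k =>
    (IsTempered.snd hω.le hl hβ k).of_abs_le fun x => by rw [abs_abs]
  exact ((((((IsTempered.const 1).add hω.le hl hβ (ha _)).add hω.le hl hβ (ha _)).add hω.le hl hβ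
    (ha _)).add hω.le hl hβ (hb _)).add hω.le hl hβ (hb _)).add hω.le hl hβ (hb _)

/-- `Φ₁ = Lψ_{01}` and `LΦ₁` are tempered (sizes `kG m³`, `kGG m⁴` of 21d). -/
theorem isTempered_genTransferHot (hω : 0 < ω₂) (hl : 0 ≤ lam) (hβ : 0 ≤ β) (hγ : 0 ≤ γ)
    (hN : 3 ≤ N) :
    IsTempered ω₂ lam β γ N (genTransferHot ω₂ lam β N hN) ∧
      IsTempered ω₂ lam β γ N (genGenTransferHot ω₂ lam β γ N hN) :=
  ⟨(((isTempered_hotSize hω hl hβ hN).pow 3).const_mul (kG ω₂ lam β)).of_abs_le fun x =>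
      (abs_genTransferHot_le hω.le hl hβ hN x).trans (le_abs_self _),
    (((isTempered_hotSize hω hl hβ hN).pow 4).const_mul (kGG ω₂ lam β γ)).of_abs_le fun x =>
      (abs_genGenTransferHot_le hω.le hl hβ hγ hN x).trans (le_abs_self _)⟩

/-- `∂_{q_l}Φ₁`, `∂_{p_l}Φ₁`, `∂²_{p_l}Φ₁` are tempered (explicit forms of 21b). -/
theorem isTempered_partial_genTransferHot (hω : 0 < ω₂) (hl : 0 ≤ lam) (hβ : 0 ≤ β) (hN : 3 ≤ N)
    (l : Fin N) :
    IsTempered ω₂ lam β γ N (partialQ l (genTransferHot ω₂ lam β N hN)) ∧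
      IsTempered ω₂ lam β γ N (partialP l (genTransferHot ω₂ lam β N hN)) ∧
        IsTempered ω₂ lam β γ N (partialP l (partialP l (genTransferHot ω₂ lam β N hN))) := by
  have H0 := hω.le
  have s0 := IsTempered.snd (γ := γ) H0 hl hβ (site0 hN)
  have s1 := IsTempered.snd (γ := γ) H0 hl hβ (site1 hN)
  obtain ⟨ph, dph, ddph⟩ :=
    isTempered_transferPhi (ω₂ := ω₂) (lam := lam) (γ := γ) hβ (site0 hN) (site1 hN)
  obtain ⟨pf1, ps1⟩ := isTempered_pinForce (γ := γ) hω hl hβ (site1 hN)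
  obtain ⟨bf10, bs10⟩ := isTempered_bondForce (γ := γ) hω hl hβ (site0 hN) (site1 hN)
  obtain ⟨bf21, bs21⟩ := isTempered_bondForce (γ := γ) hω hl hβ (site1 hN) (site2 hN)
  refine ⟨?_, ?_, ?_⟩
  · exact (((((((s1.sub H0 hl hβ s0).mul s1).mul ddph).sub H0 hl hβ
      (((pf1.add H0 hl hβ bf10).sub H0 hl hβ bf21).mul dph)).sub H0 hl hβ (bs10.mul ph)).mul
      (IsTempered.const _)).sub H0 hl hβ ((ps1.mul ph).mul (IsTempered.const _))).add H0 hl hβ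
      ((bs21.mul ph).mul (IsTempered.const _)) |>.of_eq (partialQ_genTransferHot hN hβ l)
  · exact ((((IsTempered.const _).mul s1).add H0 hl hβ ((s1.sub H0 hl hβ s0).mul
      (IsTempered.const _))).mul dph).of_eq (partialP_genTransferHot hN l)
  · exact ((IsTempered.const _).mul dph).of_eq (partialP_partialP_genTransferHot hN l)

/-- The Hessian entries `∂²_{q_i q_b}Φ(q)` of the pinned chain are tempered (polynomials). -/
theorem isTempered_hessPotential (hω : 0 < ω₂) (hl : 0 ≤ lam) (hβ : 0 ≤ β) (i b : Fin N) :
    IsTempered ω₂ lam β γ N fun x => (pinnedChain ω₂ lam β γ).hessPotential N i b x.1 := by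
  have H0 := hω.le
  have hq := fun k : Fin N => IsTempered.fst (γ := γ) hω hl hβ k
  unfold OscillatorChain.hessPotential
  simp only [Literature.Barriers.AtomisticToContinuum.pinnedChain_deriv_deriv_U,
    pinnedChain_deriv_deriv_V]
  refine (IsTempered.mul ((IsTempered.const ω₂).add H0 hl hβ (((hq i).pow 2).const_mul (3 * lam)))
    (IsTempered.const _)).add H0 hl hβ
    (IsTempered.sum H0 hl hβ _ fun k _ => IsTempered.sum H0 hl hβ _ fun l _ => ?_)
  by_cases h : l.val = k.val + 1
  · simp only [if_pos h]
    exact (((IsTempered.const 1).add H0 hl hβ ((((hq l).sub H0 hl hβ (hq k)).pow 2).const_mul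
      (3 * β))).mul (IsTempered.const _)).mul (IsTempered.const _)
  · simp only [if_neg h]
    exact IsTempered.const 0

/-! ## C. (G1b) at a generic bath end -/

/-- **(G1b), generic bath end.** Let `b ≠ j` with Hessian column `Σ_i ∂²_{q_i q_b}Φ(q) a_i =
κ_b(q) a_b - V″(q_j - q_b) a_j`, `κ_b = U″(q_b) + V″(q_j - q_b)` (true at `(b, j) = (0, 1)` and
`(N-1, N-2)`, 22b), and let `Φ = Lψ_{bj}` be given in closed form with `Φ, ∂Φ, ∂²_pΦ, LΦ` tempered
and `Φ` even in `p`.  Then `∫ p_b Ψ_T(b, j) ρ_T = T ∫ ρ_T`. -/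
theorem integral_snd_mul_transferObservable_mul_gibbsDensity (hω : 0 < ω₂) (hl : 0 ≤ lam)
    (hβ : 0 ≤ β) (γ : ℝ) {T : ℝ} (hT : 0 < T) {b j : Fin N} (hbj : b ≠ j)
    (hcol : ∀ q a : Fin N → ℝ, ∑ i, (pinnedChain ω₂ lam β γ).hessPotential N i b q * a i =
      (ω₂ + 3 * lam * q b ^ 2 + (1 + 3 * β * (q j - q b) ^ 2)) * a b
        - (1 + 3 * β * (q j - q b) ^ 2) * a j)
    {Φ : PhaseSpace N → ℝ}
    (hΦ : (pinnedChain ω₂ lam β γ).generator N T T (transferTest β N b j) = Φ)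
    (hΦt : IsTempered ω₂ lam β γ N Φ) (hΦq : ∀ l, IsTempered ω₂ lam β γ N (partialQ l Φ))
    (hΦp : ∀ l, IsTempered ω₂ lam β γ N (partialP l Φ))
    (hΦpp : ∀ l, IsTempered ω₂ lam β γ N (partialP l (partialP l Φ)))
    (hLΦ : IsTempered ω₂ lam β γ N ((pinnedChain ω₂ lam β γ).generator N T T Φ))
    (heven : ∀ x : PhaseSpace N, Φ (x.1, -x.2) = Φ x) :
    ∫ x, x.2 b * transferObservable ω₂ lam β γ T N b j x *
        (pinnedChain ω₂ lam β γ).gibbsDensity N T x =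
      T * ∫ x, (pinnedChain ω₂ lam β γ).gibbsDensity N T x := by
  have hU := pinnedChain_contDiff_U ω₂ lam β γ (n := ∞)
  have hV := pinnedChain_contDiff_V ω₂ lam β γ (n := ∞)
  have hψ4 : ContDiff ℝ 4 (transferTest β N b j) := contDiff_transferTest hβ b j
  have hψc : Continuous (transferTest β N b j) := hψ4.continuous
  have hψ2 : ContDiff ℝ 2 (transferTest β N b j) := hψ4.of_le (by norm_num)
  have hψt := fun l => isTempered_transferTest (γ := γ) hω hl hβ b j l
  have hΦ2 : ContDiff ℝ 2 Φ := hΦ ▸ contDiff_generator_of_contDiff _ hU hV T T hψ4 (m := 2) (by norm_num)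
  have hLΦc : Continuous ((pinnedChain ω₂ lam β γ).generator N T T Φ) :=
    (contDiff_generator_of_contDiff _ hU hV T T hΦ2 (m := 0) (by norm_num)).continuous
  have hpb : Continuous fun x : PhaseSpace N => x.2 b := (continuous_apply b).comp continuous_snd
  -- `Ψ = LΦ - γΦ + κψ` and the splitting of `∫ p_b Ψ ρ_T`
  have eΨ : ∀ x, transferObservable ω₂ lam β γ T N b j x =
      (pinnedChain ω₂ lam β γ).generator N T T Φ x - γ * Φ x
        + (ω₂ + 3 * lam * x.1 b ^ 2 + (1 + 3 * β * (x.1 j - x.1 b) ^ 2)) * transferTest β N b j x :=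
    fun x => by unfold transferObservable; rw [hΦ]
  have hκψc : Continuous fun x : PhaseSpace N =>
      (ω₂ + 3 * lam * x.1 b ^ 2 + (1 + 3 * β * (x.1 j - x.1 b) ^ 2)) * transferTest β N b j x := by
    fun_prop
  have hκψt : IsTempered ω₂ lam β γ N fun x : PhaseSpace N =>
      (ω₂ + 3 * lam * x.1 b ^ 2 + (1 + 3 * β * (x.1 j - x.1 b) ^ 2)) * transferTest β N b j x :=
    (((IsTempered.const ω₂).add hω.le hl hβ
      (((IsTempered.fst hω hl hβ b).pow 2).const_mul (3 * lam))).add hω.le hl hβ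
      ((IsTempered.const 1).add hω.le hl hβ ((((IsTempered.fst hω hl hβ j).sub hω.le hl hβ
        (IsTempered.fst hω hl hβ b)).pow 2).const_mul (3 * β)))).mul (hψt b).1
  have I1 : Integrable fun x => x.2 b * (pinnedChain ω₂ lam β γ).generator N T T Φ x *
      (pinnedChain ω₂ lam β γ).gibbsDensity N T x :=
    ((IsTempered.snd hω.le hl hβ b).mul hLΦ).integrable_mul_gibbsDensity (hpb.mul hLΦc) hω hl hβ hT
  have I2 : Integrable fun x => x.2 b * Φ x * (pinnedChain ω₂ lam β γ).gibbsDensity N T x :=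
    ((IsTempered.snd hω.le hl hβ b).mul hΦt).integrable_mul_gibbsDensity (hpb.mul hΦ2.continuous)
      hω hl hβ hT
  have I3 : Integrable fun x => x.2 b * ((ω₂ + 3 * lam * x.1 b ^ 2 + (1 + 3 * β * (x.1 j - x.1 b) ^ 2))
      * transferTest β N b j x) * (pinnedChain ω₂ lam β γ).gibbsDensity N T x :=
    ((IsTempered.snd hω.le hl hβ b).mul hκψt).integrable_mul_gibbsDensity (hpb.mul hκψc) hω hl hβ hT
  have I5 : Integrable fun x => x.2 j ^ 2 * (pinnedChain ω₂ lam β γ).gibbsDensity N T x :=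
    ((IsTempered.snd hω.le hl hβ j).pow 2).integrable_mul_gibbsDensity
      (((continuous_apply j).comp continuous_snd).pow 2) hω hl hβ hT
  -- (ADJ-p) `∫ p_b LΦ ρ = ∫ ∂_{q_b}H Φ ρ - γw_b ∫ p_bΦ ρ`; `∫ p_bΦ ρ = 0` (odd); `∫ p_b κψ ρ = 0`; `∫ p_j² ρ = T∫ρ`
  have J1 := integral_snd_mul_generator_mul_gibbsDensity_eq hω hl hβ γ hT b hΦ2 hΦt hΦq hΦp hΦpp
  have J2 : ∫ x, x.2 b * Φ x * (pinnedChain ω₂ lam β γ).gibbsDensity N T x = 0 :=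
    OddSectorIrreversibility.Corrector.integral_mul_gibbsDensity_eq_zero_of_odd
      (pinnedChain ω₂ lam β γ) N T fun x => by
        show (-x.2) b * Φ (x.1, -x.2) = -(x.2 b * Φ x); rw [heven x, Pi.neg_apply]; ring
  have J3 : ∫ x, x.2 b * ((ω₂ + 3 * lam * x.1 b ^ 2 + (1 + 3 * β * (x.1 j - x.1 b) ^ 2)) *
      transferTest β N b j x) * (pinnedChain ω₂ lam β γ).gibbsDensity N T x = 0 :=
    integral_snd_mul_gibbsDensity_eq_zero hω hl hβ γ hT b hκψc hκψt fun x t => by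
      simp [transferTest, Function.update_of_ne hbj.symm]
  have J5 : ∫ x, x.2 j ^ 2 * (pinnedChain ω₂ lam β γ).gibbsDensity N T x =
      T * ∫ x, (pinnedChain ω₂ lam β γ).gibbsDensity N T x := by
    simpa using integral_snd_sq_mul_gibbsDensity_eq hω hl hβ γ hT j (F := fun _ => (1 : ℝ))
      continuous_const (IsTempered.const 1) (fun _ _ => rfl)
  -- (ADJ-q) with `g = ∂_{q_b}Φ`, then the Hessian column and `V″ψ = p_j`
  have eH : ∀ x : PhaseSpace N, partialQ b ((pinnedChain ω₂ lam β γ).hamiltonian N) x =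
      (pinnedChain ω₂ lam β γ).dPotential N b x.1 := fun x =>
    (pinnedChain ω₂ lam β γ).partialQ_hamiltonian_eq_dPotential
      ((pinnedChain_contDiff_U ω₂ lam β γ (n := 1)).differentiable (by norm_num))
      ((pinnedChain_contDiff_V ω₂ lam β γ (n := 1)).differentiable (by norm_num)) N x b
  have hG : IsTempered ω₂ lam β γ N fun y : PhaseSpace N =>
      (pinnedChain ω₂ lam β γ).dPotential N b y.1 :=
    (IsTempered.partialQ_hamiltonian hω hl hβ b).of_eq fun x => (eH x).symm
  have hGq : ∀ i, IsTempered ω₂ lam β γ N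
      (partialQ i fun y : PhaseSpace N => (pinnedChain ω₂ lam β γ).dPotential N b y.1) := fun i =>
    (isTempered_hessPotential hω hl hβ i b).of_eq (partialQ_dPotential_comp_fst ω₂ lam β γ b i)
  have hg1 : ContDiff ℝ 1 ((pinnedChain ω₂ lam β γ).dPotential N b) :=
    (pinnedChain ω₂ lam β γ).contDiff_dPotential_of_succ (pinnedChain_contDiff_U ω₂ lam β γ)
      (pinnedChain_contDiff_V ω₂ lam β γ) N b
  have J4 : ∫ x, partialQ b ((pinnedChain ω₂ lam β γ).hamiltonian N) x * Φ x *
      (pinnedChain ω₂ lam β γ).gibbsDensity N T x =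
        T * ∫ x, (pinnedChain ω₂ lam β γ).gibbsDensity N T x := by
    simp only [eH]
    rw [← hΦ, integral_comp_fst_mul_generator_mul_gibbsDensity_eq hω hl hβ γ hT hg1 hG hGq hψ2
      (hψt b).1 (fun l => (hψt l).2.1) (fun l => (hψt l).2.2.1) (fun l => (hψt l).2.2.2)]
    simp only [partialQ_dPotential_comp_fst]
    have ecol : ∀ x : PhaseSpace N, ∑ i, x.2 i * (pinnedChain ω₂ lam β γ).hessPotential N i b x.1 =
        (ω₂ + 3 * lam * x.1 b ^ 2 + (1 + 3 * β * (x.1 j - x.1 b) ^ 2)) * x.2 b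
          - (1 + 3 * β * (x.1 j - x.1 b) ^ 2) * x.2 j := fun x => by
      rw [← hcol x.1 x.2]
      exact Finset.sum_congr rfl fun i _ => mul_comm _ _
    have eV : ∀ x : PhaseSpace N,
        (1 + 3 * β * (x.1 j - x.1 b) ^ 2) * transferTest β N b j x = x.2 j := fun x => by
      have hD : (0 : ℝ) < 1 + 3 * β * (x.1 j - x.1 b) ^ 2 := by positivity
      unfold transferTest
      field_simp
    have e4 : ∀ x : PhaseSpace N,
        ((ω₂ + 3 * lam * x.1 b ^ 2 + (1 + 3 * β * (x.1 j - x.1 b) ^ 2)) * x.2 b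
            - (1 + 3 * β * (x.1 j - x.1 b) ^ 2) * x.2 j) * transferTest β N b j x *
          (pinnedChain ω₂ lam β γ).gibbsDensity N T x =
        x.2 b * ((ω₂ + 3 * lam * x.1 b ^ 2 + (1 + 3 * β * (x.1 j - x.1 b) ^ 2)) *
            transferTest β N b j x) * (pinnedChain ω₂ lam β γ).gibbsDensity N T x
          - x.2 j ^ 2 * (pinnedChain ω₂ lam β γ).gibbsDensity N T x := fun x => by
      linear_combination (-(x.2 j * (pinnedChain ω₂ lam β γ).gibbsDensity N T x)) * eV x
    simp only [ecol, e4]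
    rw [integral_sub I3 I5, J3, J5]
    ring
  -- assembly
  have esplit : ∀ x : PhaseSpace N, x.2 b * transferObservable ω₂ lam β γ T N b j x *
      (pinnedChain ω₂ lam β γ).gibbsDensity N T x =
    (x.2 b * (pinnedChain ω₂ lam β γ).generator N T T Φ x * (pinnedChain ω₂ lam β γ).gibbsDensity N T x
      - γ * (x.2 b * Φ x * (pinnedChain ω₂ lam β γ).gibbsDensity N T x))
      + x.2 b * ((ω₂ + 3 * lam * x.1 b ^ 2 + (1 + 3 * β * (x.1 j - x.1 b) ^ 2)) *
          transferTest β N b j x) * (pinnedChain ω₂ lam β γ).gibbsDensity N T x := fun x => by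
    rw [eΨ]
    ring
  have I12 : Integrable fun x => x.2 b * (pinnedChain ω₂ lam β γ).generator N T T Φ x *
      (pinnedChain ω₂ lam β γ).gibbsDensity N T x
        - γ * (x.2 b * Φ x * (pinnedChain ω₂ lam β γ).gibbsDensity N T x) := I1.sub (I2.const_mul γ)
  simp only [esplit]
  rw [integral_add I12 I3, integral_sub I1 (I2.const_mul γ), integral_const_mul, J1, J2, J3, J4]
  ring

/-! ## D. The two bath ends -/

/-- `Φ₁` is even under the momentum flip. -/
theorem genTransferHot_flip (hN : 3 ≤ N) (x : PhaseSpace N) :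
    genTransferHot ω₂ lam β N hN (x.1, -x.2) = genTransferHot ω₂ lam β N hN x := by
  simp only [genTransferHot, Pi.neg_apply]; ring

/-- The site reflection commutes with the momentum flip. -/
theorem siteReflection_flip (x : PhaseSpace N) :
    siteReflection N (x.1, -x.2) = ((siteReflection N x).1, -(siteReflection N x).2) := by
  ext i <;> simp

/-- **(G1b), hot end:** `∫ p_0 Ψ_T(0,1) ρ_T = T ∫ ρ_T` (`N ≥ 3`). -/
theorem integral_snd_mul_transferObservable_hot (hω : 0 < ω₂) (hl : 0 ≤ lam) (hβ : 0 ≤ β)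
    (hγ : 0 ≤ γ) {T : ℝ} (hT : 0 < T) (hN : 3 ≤ N) :
    ∫ x, x.2 (site0 hN) * transferObservable ω₂ lam β γ T N (site0 hN) (site1 hN) x *
        (pinnedChain ω₂ lam β γ).gibbsDensity N T x =
      T * ∫ x, (pinnedChain ω₂ lam β γ).gibbsDensity N T x :=
  integral_snd_mul_transferObservable_mul_gibbsDensity hω hl hβ γ hT (site0_ne_site1 hN)
    (fun q a => sum_hessPotential_col_zero_mul ω₂ lam β γ (by omega) q a)
    (generator_transferTest_hot_eq hN hβ T T)
    (isTempered_genTransferHot hω hl hβ hγ hN).1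
    (fun l => (isTempered_partial_genTransferHot hω hl hβ hN l).1)
    (fun l => (isTempered_partial_genTransferHot hω hl hβ hN l).2.1)
    (fun l => (isTempered_partial_genTransferHot hω hl hβ hN l).2.2)
    ((isTempered_genTransferHot hω hl hβ hγ hN).2.of_eq (generator_genTransferHot hN hβ T T))
    (genTransferHot_flip hN)

/-- **(G1b), cold end:** `∫ p_{N-1} Ψ_T(N-1,N-2) ρ_T = T ∫ ρ_T` (`N ≥ 3`; `Lψ_cold = Φ₁ ∘ R`). -/
theorem integral_snd_mul_transferObservable_cold (hω : 0 < ω₂) (hl : 0 ≤ lam) (hβ : 0 ≤ β)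
    (hγ : 0 ≤ γ) {T : ℝ} (hT : 0 < T) (hN : 3 ≤ N) :
    ∫ x, x.2 ⟨N - 1, by omega⟩ *
        transferObservable ω₂ lam β γ T N ⟨N - 1, by omega⟩ ⟨N - 1 - 1, by omega⟩ x *
        (pinnedChain ω₂ lam β γ).gibbsDensity N T x =
      T * ∫ x, (pinnedChain ω₂ lam β γ).gibbsDensity N T x := by
  have hV := pinnedChain_V_neg ω₂ lam β γ
  have hΦ : (pinnedChain ω₂ lam β γ).generator N T T
      (transferTest β N ⟨N - 1, by omega⟩ ⟨N - 1 - 1, by omega⟩) =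
        genTransferHot ω₂ lam β N hN ∘ siteReflection N := by
    rw [last_eq_rev_site0 hN, lastButOne_eq_rev_site1 hN, generator_transferTest_rev,
      generator_transferTest_hot_eq hN hβ]
  have hne : (⟨N - 1, by omega⟩ : Fin N) ≠ ⟨N - 1 - 1, by omega⟩ := by
    simp only [ne_eq, Fin.mk.injEq]; omega
  obtain ⟨hΦ₁, hLΦ₁⟩ := isTempered_genTransferHot hω hl hβ hγ hN
  exact integral_snd_mul_transferObservable_mul_gibbsDensity hω hl hβ γ hT hne
    (fun q a => sum_hessPotential_col_last_mul ω₂ lam β γ (by omega) q a) hΦ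
    hΦ₁.comp_siteReflection
    (fun l => ((isTempered_partial_genTransferHot hω hl hβ hN (Fin.rev l)).1.comp_siteReflection).of_eq
      (partialQ_comp_siteReflection l _))
    (fun l => ((isTempered_partial_genTransferHot hω hl hβ hN (Fin.rev l)).2.1.comp_siteReflection).of_eq
      (partialP_comp_siteReflection l _))
    (fun l => ((isTempered_partial_genTransferHot hω hl hβ hN (Fin.rev l)).2.2.comp_siteReflection).of_eq
      (partialP_partialP_comp_siteReflection l _))
    (hLΦ₁.comp_siteReflection.of_eq fun x => by
      rw [(pinnedChain ω₂ lam β γ).generator_comp_siteReflection hV N T T, Function.comp_apply,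
        generator_genTransferHot hN hβ])
    (fun x => by simp only [Function.comp_apply, siteReflection_flip, genTransferHot_flip])

/-- **(G1b) under the Gibbs measure**, both ends: `∫ p_0 Ψ_T(0,1) dμ_T = T` and
`∫ p_{N-1} Ψ_T(N-1,N-2) dμ_T = T`. -/
theorem integral_snd_mul_transferObservable_gibbsMeasure (hω : 0 < ω₂) (hl : 0 ≤ lam) (hβ : 0 ≤ β)
    (hγ : 0 ≤ γ) {T : ℝ} (hT : 0 < T) (hN : 3 ≤ N) :
    ∫ x, x.2 ⟨0, by omega⟩ * transferObservable ω₂ lam β γ T N ⟨0, by omega⟩ ⟨1, by omega⟩ x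
        ∂(pinnedChain ω₂ lam β γ).gibbsMeasure N T = T ∧
      ∫ x, x.2 ⟨N - 1, by omega⟩ *
          transferObservable ω₂ lam β γ T N ⟨N - 1, by omega⟩ ⟨N - 1 - 1, by omega⟩ x
        ∂(pinnedChain ω₂ lam β γ).gibbsMeasure N T = T := by
  have hZ : 0 < ∫ x, (pinnedChain ω₂ lam β γ).gibbsDensity N T x :=
    integral_exp_pos (pinnedChain_integrable_gibbsDensity hω hl hβ γ N hT)
  refine ⟨?_, ?_⟩
  · rw [(pinnedChain ω₂ lam β γ).integral_gibbsMeasure, integral_snd_mul_transferObservable_hot hω hl hβ hγ hT hN]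
    field_simp
  · rw [(pinnedChain ω₂ lam β γ).integral_gibbsMeasure, integral_snd_mul_transferObservable_cold hω hl hβ hγ hT hN]
    field_simp
end Summit.AtomisticToContinuum.FouriersLaw.Theorems.SubdiffusiveBondHeat.EscapeGrading
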